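import Summits.AnomalousDissipation.AnomalousDissipation.Theorems.SolenoidalFractalHomogenisationLagrangianStepSidebandSlotDefs
import HarnessLib

/-!
# K1L_D `stub_D1_residueTail` (registry v17, stmt-AnomalousDissipation-27980) — lane A4 brick E-0: THE COORDINATE MASK of the truncated sideband
# state space (shared definition; `--kind definition --supports stmt-AnomalousDissipation-27980 --as helper`)

Summits-side DEFINITIONS file of route `SolenoidalFractalHomogenisation` (prover seat `ad-sawtooth-k1loc-p1` g13; lane A of the tail certificate
`Lines/onelevel-D1-tail-cert.md`, case E «adjacent non-colinear slot pairs»).  Objects of `…SidebandDefs` (definition of record D26-3) only.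
* `maskL R A : Space R →L[ℂ] Space R` — keep the fibres `z ∈ A`, zero every other fibre (an orthogonal coordinate projection of the truncated
  state space).  The support argument of case E reads: the part of the response of the source slot `j'` OFF the ladder `±m_{j'} + ℤ m_j` is an
  orbit of the masked homogeneous dynamics during the slots `j'` and `j`, hence decays through the whole slot `j'` before the pickup slot `j`
  reads it — while the pickup functional of slot `j` only reads fibres off that ladder (`m_j ∦ m_{j'}`).
Definitions + unfolding lemmas only; no theorem of substance, no named fact, no sorry.  NOT a proof of anything; rung leaf F-D1 infrastructure.
-/

set_option linter.dupNamespace false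

noncomputable section

namespace Summit.AnomalousDissipation.AnomalousDissipation.Theorems.SolenoidalFractalHomogenisation.LagrangianStep.Sideband

open Set MeasureTheory Complex
open scoped InnerProductSpace
open Literature.Analysis Literature.Analysis.FunctionSpaces Literature.Analysis.FunctionSpaces.Torus
open Literature.Analysis.FluidPDE Literature.Analysis.FluidPDE.Torus Literature.Analysis.FluidPDE.LatticeShear

variable {k₀ : ℕ}

/-! ## §1 The coordinate mask -/

/-- **The coordinate mask onto a set `A` of lattice points**: `(maskL R A y)_z = y_z` if `z ∈ A`, `0` otherwise (an orthogonal projection of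
`Space R` commuting with every fibrewise operation). [cite: MajdaKramer1999, §2.2.1.3 (cell problem (49))] -/
def maskL (R : ℕ) (A : Set (Fin 3 → ℤ)) : Space R →L[ℂ] Space R :=
  open Classical in
  ((PiLp.continuousLinearEquiv 2 ℂ (fun _ : box R => EuclideanSpace ℂ (Fin 3))).symm :
      (box R → EuclideanSpace ℂ (Fin 3)) →L[ℂ] Space R).comp
    (ContinuousLinearMap.pi fun z : box R =>
      if (z : Fin 3 → ℤ) ∈ A then PiLp.proj 2 (fun _ : box R => EuclideanSpace ℂ (Fin 3)) z else 0)

open Classical in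
/-- Components of `maskL`. [cite: MajdaKramer1999, §2.2.1.3] -/
theorem maskL_apply (R : ℕ) (A : Set (Fin 3 → ℤ)) (y : Space R) (z : box R) :
    maskL R A y z = if (z : Fin 3 → ℤ) ∈ A then y z else 0 := by
  simp only [maskL, ContinuousLinearMap.comp_apply]
  split_ifs <;> simp [*]

/-- Components of `maskL` on the kept fibres. [cite: MajdaKramer1999, §2.2.1.3] -/
theorem maskL_apply_of_mem {R : ℕ} {A : Set (Fin 3 → ℤ)} {z : box R} (hz : (z : Fin 3 → ℤ) ∈ A) (y : Space R) :
    maskL R A y z = y z := by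
  rw [maskL_apply, if_pos hz]

/-- Components of `maskL` on the removed fibres. [cite: MajdaKramer1999, §2.2.1.3] -/
theorem maskL_apply_of_not_mem {R : ℕ} {A : Set (Fin 3 → ℤ)} {z : box R} (hz : (z : Fin 3 → ℤ) ∉ A) (y : Space R) :
    maskL R A y z = 0 := by
  rw [maskL_apply, if_neg hz]

/-- A kept fibre read through `coordL`. [cite: MajdaKramer1999, §2.2.1.3] -/
theorem coordL_maskL_of_mem {R : ℕ} {A : Set (Fin 3 → ℤ)} {w : Fin 3 → ℤ} (hw : w ∈ A) (y : Space R) :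
    coordL R w (maskL R A y) = coordL R w y := by
  by_cases hb : w ∈ box R
  · rw [coordL_apply_of_mem hb, coordL_apply_of_mem hb]
    exact maskL_apply_of_mem (z := ⟨w, hb⟩) hw y
  · rw [coordL_apply_of_not_mem hb, coordL_apply_of_not_mem hb]

/-- A removed fibre read through `coordL`. [cite: MajdaKramer1999, §2.2.1.3] -/
theorem coordL_maskL_of_not_mem {R : ℕ} {A : Set (Fin 3 → ℤ)} {w : Fin 3 → ℤ} (hw : w ∉ A) (y : Space R) :
    coordL R w (maskL R A y) = 0 := by
  by_cases hb : w ∈ box R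
  · rw [coordL_apply_of_mem hb]
    exact maskL_apply_of_not_mem (z := ⟨w, hb⟩) hw y
  · rw [coordL_apply_of_not_mem hb]

end Summit.AnomalousDissipation.AnomalousDissipation.Theorems.SolenoidalFractalHomogenisation.LagrangianStep.Sideband

end
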